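import Mathlib.Tactic

/-!
# PercRepro — THE FIBRE MULTIPLICITY WITH `15` AT `ν = 3` (p8 g4, S3 §3q′)

`proofs/SUBCLAIM-S3-p8.md` §3q′. `mult15 ν` = twice the number of pairs a rank-`q` set of `q + ν` elements is guaranteed
to reach: the triple's `ν(3ν − 1)` (`S2.card_pairs_ge_tri`, RankLevelSetTripleMult) for `ν ≠ 3`, and `30 = 2·15` at
`ν = 3` (`S2.card_pairs_ge_fifteen`, RankLevelSetMultFifteen). The fibre weights of the heavy / light count become
`2 / mult15 (j + 1)` — `1, 2/5, 1/15, 2/22, 2/35, 2/51, …` (RankLevelSetMultFifteenCount); the level-`6` arithmetic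
modules of the `31` row evaluate them by `norm_num [Matroid.mult15]`. A definition-only module (level `0`) so that the
count module and the arithmetic modules share it. Axioms: standard (propext).
-/

namespace PercRepro

namespace Matroid

/-- **The fibre multiplicity with `15` at `ν = 3`** (twice the number of pairs a rank-`q` set of `q + ν` elements is
guaranteed to reach): `ν(3ν − 1)` for `ν ≠ 3` (the triple), `30` at `ν = 3`. -/
def mult15 (ν : ℕ) : ℕ := if ν = 3 then 30 else ν * (3 * ν - 1)

/-- `mult15` is at least the triple's `ν(3ν − 1)`. -/
theorem tri_le_mult15 (ν : ℕ) : ν * (3 * ν - 1) ≤ mult15 ν := by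
  unfold mult15
  split_ifs with h
  · subst h; norm_num
  · exact le_refl _

/-- `mult15 ν ≥ 2` for `ν ≥ 1`. -/
theorem two_le_mult15 (ν : ℕ) (hν : 1 ≤ ν) : 2 ≤ mult15 ν := by
  refine le_trans ?_ (tri_le_mult15 ν)
  have : 2 ≤ 3 * ν - 1 := by omega
  calc 2 = 1 * 2 := by norm_num
    _ ≤ ν * (3 * ν - 1) := Nat.mul_le_mul hν this

/-- `mult15 3 = 30`. -/
theorem mult15_three : mult15 3 = 30 := by unfold mult15; rfl

/-- The first weights: `mult15 1 = 2`, `mult15 2 = 10`, `mult15 4 = 44`, `mult15 5 = 70`. -/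
theorem mult15_small : mult15 1 = 2 ∧ mult15 2 = 10 ∧ mult15 4 = 44 ∧ mult15 5 = 70 := by
  unfold mult15; norm_num

end Matroid

end PercRepro
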